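import Mathlib
import Summits.CriticalPhenomena.PercolationContinuityZ3.Theorems.PercNearOneGluingAdditiveGluingSigmaRecursion
import Summits.CriticalPhenomena.PercolationContinuityZ3.Theorems.PercNearOneGluingAdditiveGluingSigmaLaw
import Summits.CriticalPhenomena.PercolationContinuityZ3.Theorems.PercNearOneGluingAdditiveGluingSigmaGeometry
import Summits.CriticalPhenomena.PercolationContinuityZ3.Theorems.PercNearOneGluingAdditiveGluingGluingLemma5
import HarnessLib

/-!
# Crux `PercNearOneGluing.NoHeavyLowerTail` (stmt-CriticalPhenomena-4575), line `bhk-superadditivity-thinning` —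
# stub `blockStarGluing`: additive gluing for a star-attached observer block

Lead prover-line-stmt-CriticalPhenomena-4575-c5-0, 2026-08-16.  Proves exactly the registered stub signature
`blockStarGluing`; lands with `--supports stmt-CriticalPhenomena-4575`.

## Content

Finite weighted graph on `Fin n`, weights `w : Sym2 (Fin n) → unitInterval`, an OBSERVER BLOCK `O`
contracted (`μ = prodBernoulli (glue w O)`, `glue w O = fun e => if (∀ x ∈ e, x ∈ O) ∧ ¬ e.IsDiag then 1
else w e`, weight `1` on the non-loop pairs inside `O`), a relay set `A` disjoint from `O`, a target
`b ∈ A`, and the STAR-ATTACHMENT hypothesis: every positive-weight pair leaving `O` ends in `A`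
(`∀ x ∈ O, ∀ y ∉ O ∪ A, w s(x, y) = 0`).  If every relay is reliable, `μ(a ↔ b) ≥ 1 − t` for all
`a ∈ A` (`0 ≤ t`), then

  `μ(O ↔ A) − t ≤ μ(O ↔ b)`.

This is Kozma–Nitzan (arXiv:2401.12397) Thm 4 in additive, block form; it is the base case (no free
pocket) of the lead's pocket-size induction.

## Proof

A verbatim generalisation of `stub_agIsolated` (file `…AdditiveGluingPartial.lean`) from the one-vertex
block `{o}` to `O`.  Pick the relay `a₀ ∈ A` minimising `P_{kill w O}(x ↔ b)` over `x ∈ A`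
(`kill w O = fun e => if (∃ x ∈ e, x ∈ O) then 0 else w e`).  One application of the σ-recursion engine
`stub_sigmaRecursion` at the block `O` (geometry `stub_sigmaGeometry`, law `stub_sigmaLaw`) gives
`μ(O ↔ A) − μ(O ↔ b) ≤ 1 − μ(a₀ ↔ b)`, provided (i) on every positive layer `S` meeting `A` at `v` with
`b ∉ S` the Lemma-5 comparison holds — this is `stub_gluingLemma5` for the weights `kill w O`, fed with the
minimality `P_{kill w O}(a₀ ↔ b) ≤ P_{kill w O}(v ↔ b)`; and (ii) the designated inequality on non-empty
positive layers avoiding `A` — vacuous, because a vertex `x` of such a layer satisfies `x ∉ O`, `x ∉ A`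
and `w s(o, x) ≠ 0` for some `o ∈ O`, contradicting star-attachment.  Finally `1 − μ(a₀ ↔ b) ≤ t` by
the relay hypothesis at `a₀`.
-/

namespace Summit.CriticalPhenomena.PercolationContinuityZ3.Theorems

open MeasureTheory Set
open Literature.Probability.LatticeModels (prodBernoulli)
open Literature.Probability.Percolation (BondConfig openConn)

noncomputable section
open Classical

/-- **Additive gluing for a star-attached observer block** (Kozma–Nitzan arXiv:2401.12397 Thm 4,
additive block form; registered stub `blockStarGluing` of crux stmt-CriticalPhenomena-4575, line
`bhk-superadditivity-thinning`).  With the block `O` contracted (`glue w O`), `A` disjoint from `O`,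
`b ∈ A`, every positive-weight pair leaving `O` ending in `A`, `0 ≤ t` and `μ(a ↔ b) ≥ 1 − t` for all
`a ∈ A`:  `μ(O ↔ A) − t ≤ μ(O ↔ b)`.  Proof: the σ-recursion engine at the block `O` with the relay
minimising `P_{kill w O}(· ↔ b)`; layers meeting `A` are handled by KN Lemma 5, and no non-empty positive
layer avoids `A` (star-attachment). -/
theorem blockStarGluing : ∀ (n : ℕ) (w : Sym2 (Fin n) → unitInterval) (O A : Finset (Fin n)) (b : Fin n) (t : ℝ), Disjoint O A → b ∈ A → (∀ x ∈ O, ∀ y : Fin n, y ∉ O → y ∉ A → w s(x, y) = 0) → 0 ≤ t → (∀ a ∈ A, 1 - t ≤ (Literature.Probability.LatticeModels.prodBernoulli (fun e : Sym2 (Fin n) => if (∀ x ∈ e, x ∈ O) ∧ ¬ e.IsDiag then 1 else w e)).real (Literature.Probability.Percolation.openConn a b)) → (Literature.Probability.LatticeModels.prodBernoulli (fun e : Sym2 (Fin n) => if (∀ x ∈ e, x ∈ O) ∧ ¬ e.IsDiag then 1 else w e)).real (⋃ o ∈ O, ⋃ x ∈ A, Literature.Probability.Percolation.openConn o x) - t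 ≤ (Literature.Probability.LatticeModels.prodBernoulli (fun e : Sym2 (Fin n) => if (∀ x ∈ e, x ∈ O) ∧ ¬ e.IsDiag then 1 else w e)).real (⋃ o ∈ O, Literature.Probability.Percolation.openConn o b) := by
  intro n w O A b t hOA hbA hiso _ht hrel
  have hbO : b ∉ O := fun h => Finset.disjoint_left.1 hOA h hbA
  -- the designated relay: minimise `P_{kill w O}(x ↔ b)` over `x ∈ A`
  obtain ⟨a₀, ha₀, hmin⟩ := Finset.exists_min_image A
    (fun x => (prodBernoulli (fun e : Sym2 (Fin n) => if (∃ x ∈ e, x ∈ O) then 0 else w e)).real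
      (openConn x b)) ⟨b, hbA⟩
  -- the σ-recursion engine at the block `O`
  have key := stub_sigmaRecursion n w O A b a₀ hOA hbO ha₀ (stub_sigmaGeometry n O)
    (stub_sigmaLaw n w O)
    (fun S _ hSA hbS => by
      -- a positive layer meeting `A` at `v`: KN Lemma 5 for the weights `kill w O`
      obtain ⟨v, hv⟩ := hSA
      rw [Finset.mem_inter] at hv
      exact stub_gluingLemma5 n (fun e : Sym2 (Fin n) => if (∃ x ∈ e, x ∈ O) then 0 else w e)
        S a₀ v b hv.1 hbS (hmin v hv.2))
    (fun S hS hSne hSA _ => by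
      -- an `A`-avoiding non-empty positive layer cannot exist (star-attachment)
      exfalso
      obtain ⟨x, hxS⟩ := hSne
      obtain ⟨hxO, o, ho, hw⟩ := hS x hxS
      have hxA : x ∉ A := fun h => Finset.disjoint_left.1 hSA hxS h
      exact hw (hiso o ho x hxO hxA))
  -- the relay hypothesis at `a₀`
  have hr := hrel a₀ ha₀
  linarith

end

end Summit.CriticalPhenomena.PercolationContinuityZ3.Theorems
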